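import Literature.AlgebraicTopology.FundamentalGroup.PlanarLassos
import HarnessLib

/-!
# Loops of a finitely punctured plane can be pushed off round discs around the punctures

Topic `Literature/AlgebraicTopology/FundamentalGroup`.  Companion of `PuncturedPlaneLassoGenerators`
and `FreeGroupPuncturedPlane`.  Let `A ⊆ ℂ` be a finite set of CENTRES and `ε > 0` a common RADIUS
with `2ε ≤ |a - a'|` for `a ≠ a'` in `A` (the closed discs `D̄(a, ε)` are essentially disjoint), and
let `F ⊆ ℂ` be a set of PUNCTURES lying in the union of the open discs `D(a, ε)`, exactly one in
each: `z a ∈ F ∩ D(a, ε)` and `F ∩ D(a, ε) = {z a}` (the punctures need NOT be the centres).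

**Theorem** (`exists_mk_eq_forall_le_dist`).  Every loop `γ` of `ℂ ∖ F` based at a point `x`
outside the open discs is homotopic, with fixed base point, to a loop `γ'` of `ℂ ∖ F` which AVOIDS
the open discs: `ε ≤ |γ'(t) - a|` for all `t` and all `a ∈ A`.  Equivalently, the inclusion
`ℂ ∖ ⋃ D(a, ε) ↪ ℂ ∖ F` is surjective on `π₁` (Hatcher, Prop. 1.17–1.18: `ℂ ∖ F` deformation
retracts onto the complement of the open discs).

Use (file `Literature/AlgebraicGeometry/FundamentalGroup/HypersurfaceComplementZariskiPencils`):
when the punctures of a punctured line MOVE inside fixed discs (a nearby line of a pencil), loops may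
be taken in the common complement of the discs, where the two punctured lines agree — the local
constancy of the image of `π₁` of the punctured lines of a pencil, the key step of Zariski's theorem
on the fundamental group of a generic line section (Voisin II, Thm. 3.22).

## Proof

The radial retraction.  For `a ∈ A` with puncture `z = z a ∈ D(a, ε)` and `w ≠ z`, the ray from `z`
through `w`, `t ↦ z + t (w - z)`, leaves the closed disc `D̄(a, ε)` at the parameter
`τ(w) = (-B + √(B² - AC)) / A > 0`, where `|z - a + t (w - z)|² - ε² = A t² + 2B t + C`
(`A = |w - z|²`, `B = Re((z - a) conj (w - z))`, `C = |z - a|² - ε² < 0`), a continuous function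
of `w ≠ z` with `τ(w) > 1` iff `w ∈ D(a, ε)`.  The map `ρ_a(w) = z + max(1, τ(w)) (w - z)` is
continuous off `z`, the identity off `D(a, ε)`, and pushes `D(a, ε) ∖ {z}` radially onto the
circle `|w - a| = ε`; the straight homotopy `w + s (ρ_a(w) - w)` runs along the ray inside
`D̄(a, ε) ∖ {z}`, hence inside `ℂ ∖ F`.  Summing the corrections over `a ∈ A` (at most one is
non-zero at any point) gives `ρ(w) = w + Σ_a (ρ_a(w) - w)` and the homotopy
`H(s, w) = w + s Σ_a (ρ_a(w) - w)` of `ℂ ∖ F` from the identity to `ρ`, fixing every point outside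
the open discs (in particular the base point); `γ' = ρ ∘ γ` and the square `(s, t) ↦ H(s, γ(t))`
(`Square.mk_trans_eq`) give the claim.

## References

* A. Hatcher, *Algebraic Topology*, CUP (2002), §0 (deformation retractions), §1.1 Prop. 1.17,
  Prop. 1.18, Lemma 1.19. [HatcherAT2002]
* C. Voisin, *Hodge Theory and Complex Algebraic Geometry II*, CUP (2003), §3.2.2, proof of
  Thm. 3.22. [VoisinHodgeII2003]

## Design notes

* Everything is proved; no definitions besides the explicit retraction data (`exitParam`,
  `radialPush`, `pushHomotopy` and the coefficients `innerB`, `constC`, `discr` of the governing quadratic), no named facts, no `sorry`.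
* `_root_.FundamentalGroup` is not needed: the statement is an equality in `Path.Homotopic.Quotient`.
-/

noncomputable section

open Set unitInterval Complex Metric
open scoped Topology

namespace Literature.AlgebraicTopology.FundamentalGroup

namespace OffDiscs

/-! ### The exit parameter of a ray from a point of a disc -/

section ExitParam

variable (a : ℂ) (ε : ℝ) (z : ℂ)

/-- `B(w) = Re((z - a) · conj (w - z))`, the real inner product `⟨z - a, w - z⟩` (linear coefficient of
the quadratic `|z - a + t (w - z)|² - ε²` governing the radial retraction). [cite: HatcherAT2002, §0 (deformation retraction of a punctured disc onto its boundary circle)] -/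
def innerB (w : ℂ) : ℝ := ((z - a) * (starRingEnd ℂ) (w - z)).re

/-- `C = |z - a|² - ε²`, the constant coefficient of the quadratic `|z - a + t (w - z)|² - ε²`
(negative when `z` lies in the open disc `D(a, ε)`). [cite: HatcherAT2002, §0 (deformation retraction of a punctured disc onto its boundary circle)] -/
def constC : ℝ := Complex.normSq (z - a) - ε ^ 2

/-- The discriminant `B² - A C` of the quadratic `|z - a + t (w - z)|² - ε² = A t² + 2 B t + C`.
[cite: HatcherAT2002, §0 (deformation retraction of a punctured disc onto its boundary circle)] -/
def discr (w : ℂ) : ℝ := innerB a z w ^ 2 - Complex.normSq (w - z) * constC a ε z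

/-- **The exit parameter** `τ(w) = (-B + √(B² - AC)) / A`: for `z ∈ D(a, ε)` and `w ≠ z`, the
unique `t > 0` with `|z + t (w - z) - a| = ε`. [cite: HatcherAT2002, §0 (deformation retraction of a punctured disc onto its boundary circle)] -/
def exitParam (w : ℂ) : ℝ :=
  (-innerB a z w + Real.sqrt (discr a ε z w)) / Complex.normSq (w - z)

variable {a ε z}

/-- The quadratic identity `|z - a + t (w - z)|² = |z - a|² + 2 B t + A t²`. [folklore] -/
private theorem normSq_add_mul (w : ℂ) (t : ℝ) :
    Complex.normSq (z - a + (t : ℂ) * (w - z)) =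
      Complex.normSq (z - a) + 2 * innerB a z w * t + Complex.normSq (w - z) * t ^ 2 := by
  rw [Complex.normSq_add, Complex.normSq_mul, Complex.normSq_ofReal, innerB]
  have h : ((z - a) * (starRingEnd ℂ) ((t : ℂ) * (w - z))).re =
      t * ((z - a) * (starRingEnd ℂ) (w - z)).re := by
    rw [map_mul, Complex.conj_ofReal, ← mul_assoc, mul_comm (z - a) (t : ℂ), mul_assoc,
      Complex.re_ofReal_mul]
  rw [h]
  ring

variable (hz : z ∈ ball a ε)
include hz

/-- `C < 0` for `z` in the open disc. [folklore] -/
private theorem constC_neg : constC a ε z < 0 := by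
  have h : dist z a < ε := mem_ball.1 hz
  have hε : 0 < ε := lt_of_le_of_lt dist_nonneg h
  rw [constC, sub_neg, Complex.normSq_eq_norm_sq, ← Complex.dist_eq]
  exact pow_lt_pow_left₀ h dist_nonneg two_ne_zero |>.trans_le le_rfl |> fun h' => by
    nlinarith [h, dist_nonneg (x := z) (y := a)]

/-- The discriminant is positive off `z`: `B² - AC > B² ≥ 0` since `A > 0 > C`. [folklore] -/
private theorem innerB_sq_lt_discr {w : ℂ} (hw : w ≠ z) : innerB a z w ^ 2 < discr a ε z w := by
  have hA : 0 < Complex.normSq (w - z) := Complex.normSq_pos.2 (sub_ne_zero.2 hw)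
  have hC := constC_neg hz
  rw [discr]
  nlinarith [mul_pos hA (neg_pos.2 hC)]

/-- The discriminant is positive off `z`. [folklore] -/
private theorem discr_pos {w : ℂ} (hw : w ≠ z) : 0 < discr a ε z w :=
  lt_of_le_of_lt (sq_nonneg _) (innerB_sq_lt_discr hz hw)

/-- `τ(w) > 0`. [cite: HatcherAT2002, §0 (deformation retraction of a punctured disc onto its boundary circle)] -/
private theorem exitParam_pos {w : ℂ} (hw : w ≠ z) : 0 < exitParam a ε z w := by
  have hA : 0 < Complex.normSq (w - z) := Complex.normSq_pos.2 (sub_ne_zero.2 hw)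
  have hΔ := innerB_sq_lt_discr hz hw
  have hsq : |innerB a z w| < Real.sqrt (discr a ε z w) := by
    rw [← Real.sqrt_sq_eq_abs]
    exact Real.sqrt_lt_sqrt (sq_nonneg _) hΔ
  rw [exitParam]
  refine div_pos ?_ hA
  have := neg_abs_le (innerB a z w)
  linarith [le_abs_self (innerB a z w)]

/-- **The exit point lies on the circle**: `A τ² + 2 B τ + C = 0`, i.e.
`|z - a + τ (w - z)|² = ε²`. [cite: HatcherAT2002, §0 (deformation retraction of a punctured disc onto its boundary circle)] -/
private theorem normSq_exitParam {w : ℂ} (hw : w ≠ z) :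
    Complex.normSq (z - a + (exitParam a ε z w : ℂ) * (w - z)) = ε ^ 2 := by
  have hA : 0 < Complex.normSq (w - z) := Complex.normSq_pos.2 (sub_ne_zero.2 hw)
  have hΔ := (discr_pos hz hw).le
  set A := Complex.normSq (w - z) with hAdef
  set B := innerB a z w with hBdef
  set S := Real.sqrt (discr a ε z w) with hSdef
  have hS : S ^ 2 = B ^ 2 - A * constC a ε z := by
    rw [hSdef, Real.sq_sqrt hΔ, discr]
  have hτA : exitParam a ε z w * A = -B + S := by
    rw [exitParam, ← hAdef, ← hBdef, ← hSdef, div_mul_cancel₀ _ hA.ne']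
  rw [normSq_add_mul, ← hAdef, ← hBdef]
  have key : A * (Complex.normSq (z - a) + 2 * B * exitParam a ε z w + A * exitParam a ε z w ^ 2) =
      A * ε ^ 2 := by
    have e1 : A * exitParam a ε z w ^ 2 * A = (-B + S) ^ 2 := by
      rw [← hτA]; ring
    have : A * (Complex.normSq (z - a) + 2 * B * exitParam a ε z w + A * exitParam a ε z w ^ 2) =
        A * Complex.normSq (z - a) + 2 * B * (exitParam a ε z w * A) + A * exitParam a ε z w ^ 2 * A := by
      ring
    rw [this, hτA, e1]
    have hCdef : constC a ε z = Complex.normSq (z - a) - ε ^ 2 := rfl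
    nlinarith [hS, hCdef]
  have := mul_left_cancel₀ hA.ne' key
  linarith [this]

/-- The factorisation `A t² + 2 B t + C = A (t - τ) (t - τ₋)` with `τ₋ = (-B - √Δ)/A < 0`, in the
form used below: for `t ≥ 0`, `A t² + 2Bt + C` has the sign of `t - τ`. [folklore] -/
private theorem quadratic_eq_mul {w : ℂ} (hw : w ≠ z) (t : ℝ) :
    Complex.normSq (w - z) * t ^ 2 + 2 * innerB a z w * t + constC a ε z =
      Complex.normSq (w - z) * (t - exitParam a ε z w) *
        (t - (-innerB a z w - Real.sqrt (discr a ε z w)) / Complex.normSq (w - z)) := by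
  have hA : 0 < Complex.normSq (w - z) := Complex.normSq_pos.2 (sub_ne_zero.2 hw)
  have hΔ := (discr_pos hz hw).le
  have hS : Real.sqrt (discr a ε z w) ^ 2 = innerB a z w ^ 2 - Complex.normSq (w - z) * constC a ε z := by
    rw [Real.sq_sqrt hΔ, discr]
  rw [exitParam]
  field_simp
  nlinarith [hS]

/-- The second root `τ₋ = (-B - √Δ)/A` is negative. [folklore] -/
private theorem exitParamNeg_neg {w : ℂ} (hw : w ≠ z) :
    (-innerB a z w - Real.sqrt (discr a ε z w)) / Complex.normSq (w - z) < 0 := by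
  have hA : 0 < Complex.normSq (w - z) := Complex.normSq_pos.2 (sub_ne_zero.2 hw)
  have hΔ := innerB_sq_lt_discr hz hw
  have hsq : |innerB a z w| < Real.sqrt (discr a ε z w) := by
    rw [← Real.sqrt_sq_eq_abs]
    exact Real.sqrt_lt_sqrt (sq_nonneg _) hΔ
  refine div_neg_of_neg_of_pos ?_ hA
  linarith [neg_abs_le (innerB a z w), le_abs_self (innerB a z w)]

/-- **Inside the disc the exit parameter exceeds `1`**: `w ∈ D(a, ε)`, `w ≠ z` `⇒ τ(w) > 1`.
[cite: HatcherAT2002, §0 (deformation retraction of a punctured disc onto its boundary circle)] -/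
private theorem one_lt_exitParam {w : ℂ} (hw : w ≠ z) (hwa : w ∈ ball a ε) : 1 < exitParam a ε z w := by
  have hA : 0 < Complex.normSq (w - z) := Complex.normSq_pos.2 (sub_ne_zero.2 hw)
  by_contra hle
  push Not at hle
  -- `q(1) = |w - a|² - ε² < 0`
  have hq1 : Complex.normSq (w - z) * 1 ^ 2 + 2 * innerB a z w * 1 + constC a ε z < 0 := by
    have h := normSq_add_mul (a := a) (z := z) w 1
    rw [Complex.ofReal_one, one_mul, show z - a + (w - z) = w - a by ring] at h
    have hwa' : Complex.normSq (w - a) < ε ^ 2 := by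
      rw [Complex.normSq_eq_norm_sq, ← Complex.dist_eq]
      have hd : dist w a < ε := mem_ball.1 hwa
      exact pow_lt_pow_left₀ hd dist_nonneg two_ne_zero
    rw [constC]; nlinarith [h, hwa']
  rw [quadratic_eq_mul hz hw 1] at hq1
  have h1 : 0 ≤ 1 - exitParam a ε z w := by linarith
  have h2 : 0 < 1 - (-innerB a z w - Real.sqrt (discr a ε z w)) / Complex.normSq (w - z) := by
    linarith [exitParamNeg_neg hz hw]
  have : 0 ≤ Complex.normSq (w - z) * (1 - exitParam a ε z w) *
      (1 - (-innerB a z w - Real.sqrt (discr a ε z w)) / Complex.normSq (w - z)) :=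
    mul_nonneg (mul_nonneg hA.le h1) h2.le
  linarith

/-- **Outside the disc the exit parameter is at most `1`**: `w ∉ D(a, ε)` `⇒ τ(w) ≤ 1`.
[cite: HatcherAT2002, §0 (deformation retraction of a punctured disc onto its boundary circle)] -/
private theorem exitParam_le_one {w : ℂ} (hw : w ≠ z) (hwa : w ∉ ball a ε) : exitParam a ε z w ≤ 1 := by
  have hA : 0 < Complex.normSq (w - z) := Complex.normSq_pos.2 (sub_ne_zero.2 hw)
  by_contra hlt
  push Not at hlt
  -- `q(1) = |w - a|² - ε² ≥ 0`
  have hq1 : 0 ≤ Complex.normSq (w - z) * 1 ^ 2 + 2 * innerB a z w * 1 + constC a ε z := by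
    have h := normSq_add_mul (a := a) (z := z) w 1
    rw [Complex.ofReal_one, one_mul, show z - a + (w - z) = w - a by ring] at h
    have hwa' : ε ^ 2 ≤ Complex.normSq (w - a) := by
      rw [Complex.normSq_eq_norm_sq, ← Complex.dist_eq]
      have hd : ε ≤ dist w a := not_lt.1 fun h' => hwa (mem_ball.2 h')
      have hε : 0 < ε := lt_of_le_of_lt dist_nonneg (mem_ball.1 hz)
      exact pow_le_pow_left₀ hε.le hd 2
    rw [constC]; nlinarith [h, hwa']
  rw [quadratic_eq_mul hz hw 1] at hq1
  have h1 : 1 - exitParam a ε z w < 0 := by linarith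
  have h2 : 0 < 1 - (-innerB a z w - Real.sqrt (discr a ε z w)) / Complex.normSq (w - z) := by
    linarith [exitParamNeg_neg hz hw]
  have : Complex.normSq (w - z) * (1 - exitParam a ε z w) *
      (1 - (-innerB a z w - Real.sqrt (discr a ε z w)) / Complex.normSq (w - z)) < 0 :=
    mul_neg_of_neg_of_pos (mul_neg_of_pos_of_neg hA h1) h2
  linarith

/-- Along the ray, between the parameters `1` and `τ`, one stays in the closed disc:
`0 ≤ t ≤ τ(w)` `⇒ |z - a + t (w - z)| ≤ ε`. [cite: HatcherAT2002, §0 (deformation retraction of a punctured disc onto its boundary circle)] -/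
private theorem normSq_le_of_le_exitParam {w : ℂ} (hw : w ≠ z) {t : ℝ} (ht0 : 0 ≤ t)
    (ht : t ≤ exitParam a ε z w) : Complex.normSq (z - a + (t : ℂ) * (w - z)) ≤ ε ^ 2 := by
  have hA : 0 < Complex.normSq (w - z) := Complex.normSq_pos.2 (sub_ne_zero.2 hw)
  rw [normSq_add_mul]
  have hq : Complex.normSq (w - z) * t ^ 2 + 2 * innerB a z w * t + constC a ε z ≤ 0 := by
    rw [quadratic_eq_mul hz hw t]
    have h1 : t - exitParam a ε z w ≤ 0 := by linarith
    have h2 : 0 ≤ t - (-innerB a z w - Real.sqrt (discr a ε z w)) / Complex.normSq (w - z) := by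
      linarith [exitParamNeg_neg hz hw]
    nlinarith [mul_nonneg (mul_nonneg hA.le (by linarith : 0 ≤ exitParam a ε z w - t)) h2]
  rw [constC] at hq
  linarith

omit hz in
/-- **Continuity of the exit parameter** off the puncture. [folklore] -/
private theorem continuousOn_exitParam : ContinuousOn (exitParam a ε z) {w | w ≠ z} := by
  have hB : Continuous (innerB a z) := by
    unfold innerB
    fun_prop
  have hA : Continuous fun w => Complex.normSq (w - z) := Complex.continuous_normSq.comp (by fun_prop)
  have hΔ : Continuous (discr a ε z) := by
    unfold discr
    exact (hB.pow 2).sub (hA.mul continuous_const)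
  refine ContinuousOn.div ?_ hA.continuousOn fun w hw => ?_
  · exact (hB.neg.add (Real.continuous_sqrt.comp hΔ)).continuousOn
  · exact (Complex.normSq_pos.2 (sub_ne_zero.2 hw)).ne'

end ExitParam

/-! ### The radial push of one punctured disc onto its boundary circle -/

section RadialPush

variable (a : ℂ) (ε : ℝ) (z : ℂ)

/-- **The radial push** `ρ_a(w) = z + max(1, τ(w)) (w - z)`: the identity outside the open disc
`D(a, ε)`, the radial projection from the puncture `z` onto the circle `|w - a| = ε` inside it.
[cite: HatcherAT2002, §0 (deformation retraction of a punctured disc onto its boundary circle)] -/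
def radialPush (w : ℂ) : ℂ := z + ((max 1 (exitParam a ε z w) : ℝ) : ℂ) * (w - z)

variable {a ε z} (hz : z ∈ ball a ε)
include hz

/-- Outside the open disc the push is the identity. [cite: HatcherAT2002, §0 (deformation retraction of a punctured disc onto its boundary circle)] -/
private theorem radialPush_of_notMem {w : ℂ} (hwa : w ∉ ball a ε) : radialPush a ε z w = w := by
  have hw : w ≠ z := fun h => hwa (h ▸ hz)
  rw [radialPush, max_eq_left (exitParam_le_one hz hw hwa), Complex.ofReal_one, one_mul,
    add_sub_cancel]

/-- Inside the open disc (off the puncture) the push lands on the circle: `|ρ_a(w) - a| = ε`.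
[cite: HatcherAT2002, §0 (deformation retraction of a punctured disc onto its boundary circle)] -/
private theorem dist_radialPush_of_mem {w : ℂ} (hw : w ≠ z) (hwa : w ∈ ball a ε) :
    dist (radialPush a ε z w) a = ε := by
  have hε : 0 < ε := lt_of_le_of_lt dist_nonneg (mem_ball.1 hz)
  rw [radialPush, max_eq_right (one_lt_exitParam hz hw hwa).le, Complex.dist_eq,
    show z + (exitParam a ε z w : ℂ) * (w - z) - a = z - a + (exitParam a ε z w : ℂ) * (w - z) by ring]
  have h := normSq_exitParam hz hw
  rw [Complex.normSq_eq_norm_sq] at h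
  nlinarith [norm_nonneg (z - a + (exitParam a ε z w : ℂ) * (w - z)), hε, sq_nonneg (‖z - a + (exitParam a ε z w : ℂ) * (w - z)‖ - ε),
    sq_nonneg (‖z - a + (exitParam a ε z w : ℂ) * (w - z)‖ + ε)]

/-- The push never lands in the open disc (off the puncture). [cite: HatcherAT2002, §0 (deformation retraction of a punctured disc onto its boundary circle)] -/
private theorem radialPush_notMem_ball {w : ℂ} (hw : w ≠ z) : radialPush a ε z w ∉ ball a ε := by
  by_cases hwa : w ∈ ball a ε
  · rw [mem_ball, dist_radialPush_of_mem hz hw hwa]; exact lt_irrefl ε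
  · rwa [radialPush_of_notMem hz hwa]

/-- **The straight homotopy to the push stays in the closed punctured disc**: for `s ∈ [0, 1]` and
`w ∈ D(a, ε) ∖ {z}`, the point `w + s (ρ_a(w) - w)` is `≠ z` and lies in `D̄(a, ε)`.
[cite: HatcherAT2002, §0 (deformation retraction of a punctured disc onto its boundary circle)] -/
private theorem segment_mem {w : ℂ} (hw : w ≠ z) (hwa : w ∈ ball a ε) {s : ℝ} (hs0 : 0 ≤ s) (hs1 : s ≤ 1) :
    w + (s : ℂ) * (radialPush a ε z w - w) ≠ z ∧ w + (s : ℂ) * (radialPush a ε z w - w) ∈ closedBall a ε := by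
  have hτ := one_lt_exitParam hz hw hwa
  -- the point is `z + μ (w - z)` with `μ = 1 + s (τ - 1) ∈ [1, τ]`
  set μ : ℝ := 1 + s * (exitParam a ε z w - 1) with hμ
  have hpt : w + (s : ℂ) * (radialPush a ε z w - w) = z + (μ : ℂ) * (w - z) := by
    rw [radialPush, max_eq_right hτ.le, hμ]
    push_cast
    ring
  have hμ1 : 1 ≤ μ := by rw [hμ]; nlinarith
  have hμτ : μ ≤ exitParam a ε z w := by rw [hμ]; nlinarith
  rw [hpt]
  refine ⟨fun h => ?_, ?_⟩
  · have : (μ : ℂ) * (w - z) = 0 := by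
      have := congrArg (· - z) h
      simpa using this
    rcases mul_eq_zero.1 this with h1 | h1
    · exact absurd (by exact_mod_cast h1 : μ = 0) (by linarith)
    · exact hw (sub_eq_zero.1 h1)
  · have hε : 0 < ε := lt_of_le_of_lt dist_nonneg (mem_ball.1 hz)
    rw [mem_closedBall, Complex.dist_eq, show z + (μ : ℂ) * (w - z) - a = z - a + (μ : ℂ) * (w - z) by ring]
    have h := normSq_le_of_le_exitParam hz hw (by linarith) hμτ
    rw [Complex.normSq_eq_norm_sq] at h
    nlinarith [norm_nonneg (z - a + (μ : ℂ) * (w - z)), hε]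

omit hz in
/-- The push is continuous off the puncture. [folklore] -/
private theorem continuousOn_radialPush : ContinuousOn (radialPush a ε z) {w | w ≠ z} := by
  unfold radialPush
  refine continuousOn_const.add (ContinuousOn.mul ?_ (by fun_prop))
  exact Complex.continuous_ofReal.comp_continuousOn
    ((continuous_const.max continuous_id).comp_continuousOn continuousOn_exitParam)

end RadialPush

/-! ### Pushing off all the discs at once -/

section PushOff

variable (A : Finset ℂ) (ε : ℝ) (z : ℂ → ℂ)

/-- The straight homotopy `H(s, w) = w + s Σ_a (ρ_a(w) - w)` from the identity (`s = 0`) to the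
total push (`s = 1`). [cite: HatcherAT2002, §0 (deformation retractions)] -/
def pushHomotopy (s : ℝ) (w : ℂ) : ℂ := w + (s : ℂ) * ∑ a ∈ A, (radialPush a ε (z a) w - w)

variable {A ε z}
variable (hsep : ∀ a ∈ A, ∀ a' ∈ A, a ≠ a' → 2 * ε ≤ dist a a') (hz : ∀ a ∈ A, z a ∈ ball a ε)
include hsep hz

omit hz in
/-- Two of the open discs do not meet; indeed `D̄(a, ε) ∩ D(a', ε) = ∅` for `a ≠ a'`. [folklore] -/
private theorem notMem_ball_of_mem_closedBall {a a' : ℂ} (ha : a ∈ A) (ha' : a' ∈ A) (h : a ≠ a') {w : ℂ}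
    (hw : w ∈ closedBall a ε) : w ∉ ball a' ε := by
  intro hw'
  have h1 : dist w a ≤ ε := mem_closedBall.1 hw
  have h2 : dist w a' < ε := mem_ball.1 hw'
  have := hsep a ha a' ha' h
  linarith [dist_triangle_left a a' w]

omit hsep in
/-- Outside all open discs the homotopy is stationary. [cite: HatcherAT2002, §0 (deformation retractions)] -/
private theorem pushHomotopy_of_forall_notMem {w : ℂ} (hw : ∀ a ∈ A, w ∉ ball a ε) (s : ℝ) :
    pushHomotopy A ε z s w = w := by
  rw [pushHomotopy, Finset.sum_eq_zero fun a ha => ?_, mul_zero, add_zero]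
  rw [radialPush_of_notMem (hz a ha) (hw a ha), sub_self]

/-- Inside the disc of `a` the homotopy is the straight homotopy to `ρ_a`. [cite: HatcherAT2002, §0 (deformation retractions)] -/
private theorem pushHomotopy_of_mem {a : ℂ} (ha : a ∈ A) {w : ℂ} (hwa : w ∈ ball a ε) (s : ℝ) :
    pushHomotopy A ε z s w = w + (s : ℂ) * (radialPush a ε (z a) w - w) := by
  rw [pushHomotopy, Finset.sum_eq_single a (fun a' ha' hne => ?_) (fun h => absurd ha h)]
  rw [radialPush_of_notMem (hz a' ha')
    (notMem_ball_of_mem_closedBall hsep ha ha' hne.symm (ball_subset_closedBall hwa)), sub_self]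

/-- **The homotopy stays in `ℂ ∖ F`.**  If every puncture lies in some open disc, `z a ∈ F`, and the
disc of `a` contains no puncture other than `z a`, then `H(s, w) ∉ F` for `w ∉ F`, `s ∈ [0, 1]`.
[cite: HatcherAT2002, §0 (deformation retractions)] -/
private theorem pushHomotopy_notMem {F : Set ℂ} (hF : ∀ u ∈ F, ∃ a ∈ A, u ∈ ball a ε) (hzF : ∀ a ∈ A, z a ∈ F)
    (huniq : ∀ a ∈ A, ∀ u ∈ F, u ∈ ball a ε → u = z a) {w : ℂ} (hw : w ∉ F) {s : ℝ} (hs0 : 0 ≤ s)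
    (hs1 : s ≤ 1) : pushHomotopy A ε z s w ∉ F := by
  by_cases hwall : ∀ a ∈ A, w ∉ ball a ε
  · rwa [pushHomotopy_of_forall_notMem hz hwall]
  push Not at hwall
  obtain ⟨a, ha, hwa⟩ := hwall
  have hwz : w ≠ z a := fun h => hw (h ▸ hzF a ha)
  rw [pushHomotopy_of_mem hsep hz ha hwa]
  obtain ⟨hne, hmem⟩ := segment_mem (hz a ha) hwz hwa hs0 hs1
  intro hmemF
  obtain ⟨a', ha', hwa'⟩ := hF _ hmemF
  by_cases haa' : a = a'
  · subst haa'
    exact hne (huniq a ha _ hmemF hwa')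
  · exact notMem_ball_of_mem_closedBall hsep ha ha' haa' hmem hwa'

/-- **The end of the homotopy avoids all the open discs.** [cite: HatcherAT2002, §0 (deformation retractions)] -/
private theorem le_dist_pushHomotopy_one {F : Set ℂ} (hzF : ∀ a ∈ A, z a ∈ F) {w : ℂ} (hw : w ∉ F) {a : ℂ}
    (ha : a ∈ A) : ε ≤ dist (pushHomotopy A ε z 1 w) a := by
  by_contra hlt
  push Not at hlt
  by_cases hwall : ∀ a ∈ A, w ∉ ball a ε
  · rw [pushHomotopy_of_forall_notMem hz hwall] at hlt
    exact hwall a ha (mem_ball.2 hlt)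
  push Not at hwall
  obtain ⟨a', ha', hwa'⟩ := hwall
  have hwz : w ≠ z a' := fun h => hw (h ▸ hzF a' ha')
  rw [pushHomotopy_of_mem hsep hz ha' hwa', Complex.ofReal_one, one_mul, add_sub_cancel] at hlt
  have h1 := radialPush_notMem_ball (hz a' ha') hwz
  by_cases haa' : a' = a
  · subst haa'; exact h1 (mem_ball.2 hlt)
  · -- the pushed point lies on the circle of `a'`, hence in `D̄(a', ε)`, hence not in `D(a, ε)`
    have hcl : radialPush a' ε (z a') w ∈ closedBall a' ε := by
      rw [mem_closedBall, dist_radialPush_of_mem (hz a' ha') hwz hwa']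
    exact notMem_ball_of_mem_closedBall hsep ha' ha haa' hcl (mem_ball.2 hlt)

omit hsep hz in
/-- The homotopy is jointly continuous in `(s, w)` off the punctures. [folklore] -/
private theorem continuousOn_pushHomotopy :
    ContinuousOn (fun p : ℝ × ℂ => pushHomotopy A ε z p.1 p.2) {p | ∀ a ∈ A, p.2 ≠ z a} := by
  unfold pushHomotopy
  refine (continuous_snd.continuousOn).add (ContinuousOn.mul (by fun_prop) ?_)
  refine continuousOn_finsetSum _ fun a ha => ContinuousOn.sub ?_ continuous_snd.continuousOn
  exact (continuousOn_radialPush (a := a) (ε := ε) (z := z a)).comp continuous_snd.continuousOn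
    fun p hp => hp a ha

end PushOff

/-! ### The theorem -/

section Main

variable {X : Type*} [TopologicalSpace X]

/-- From a square with constant bottom and top edges: two loops that are the left and right edges
of a continuous map of the square, constant on the horizontal edges, are homotopic with fixed base
point. [cite: HatcherAT2002, §1.1 Lemma 1.19] -/
theorem mk_eq_mk_of_square {x : X} (F : C(I × I, X)) (γ₀ γ₁ : Path x x) (h₀ : ∀ θ, F (0, θ) = γ₀ θ)
    (h₁ : ∀ θ, F (1, θ) = γ₁ θ) (hb : ∀ s, F (s, 0) = x) (ht : ∀ s, F (s, 1) = x) :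
    Path.Homotopic.Quotient.mk γ₀ = Path.Homotopic.Quotient.mk γ₁ := by
  have h := Square.mk_trans_eq F (Path.refl x) (Path.refl x) γ₀ γ₁ (fun s => by simpa using hb s)
    (fun s => by simpa using ht s) h₀ h₁
  simpa [Path.Homotopic.Quotient.mk_refl] using h

end Main

section Theorem

variable {A : Finset ℂ} {ε : ℝ} {z : ℂ → ℂ} {F : Set ℂ}

/-- **Loops of a finitely punctured plane can be pushed off discs around the punctures.**  Let
`A ⊆ ℂ` be finite, `2ε ≤ |a - a'|` for `a ≠ a'` in `A`, and let the punctures `F` lie in the union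
of the open discs `D(a, ε)`, with `z a ∈ F ∩ D(a, ε)` the ONLY puncture in `D(a, ε)`.  Then every
loop `γ` of `ℂ ∖ F` at a base point `x` outside the open discs is homotopic with fixed end points
to a loop `γ'` of `ℂ ∖ F` avoiding the open discs: `ε ≤ |γ'(t) - a|` for all `t`, `a ∈ A`.
(`ℂ ∖ F` deformation retracts onto the complement of the open discs, by the radial pushes from
the punctures.) [cite: HatcherAT2002, §1.1 Prop. 1.17 and Prop. 1.18 (a deformation retraction induces an isomorphism on `π₁`)]
[cite: VoisinHodgeII2003, §3.2.2 (proof of Thm. 3.22)] -/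
theorem exists_mk_eq_forall_le_dist (hsep : ∀ a ∈ A, ∀ a' ∈ A, a ≠ a' → 2 * ε ≤ dist a a')
    (hz : ∀ a ∈ A, z a ∈ ball a ε) (hzF : ∀ a ∈ A, z a ∈ F) (hF : ∀ u ∈ F, ∃ a ∈ A, u ∈ ball a ε)
    (huniq : ∀ a ∈ A, ∀ u ∈ F, u ∈ ball a ε → u = z a) {x : ↥(univ \ F)}
    (hx : ∀ a ∈ A, ε ≤ dist (x : ℂ) a) (γ : Path x x) :
    ∃ γ' : Path x x, Path.Homotopic.Quotient.mk γ = Path.Homotopic.Quotient.mk γ' ∧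
      ∀ t, ∀ a ∈ A, ε ≤ dist (γ' t : ℂ) a := by
  have hγF : ∀ t, (γ t : ℂ) ∉ F := fun t => (γ t).2.2
  have hγz : ∀ t, ∀ a ∈ A, (γ t : ℂ) ≠ z a := fun t a ha h => hγF t (h ▸ hzF a ha)
  -- the square `(s, θ) ↦ H(s, γ θ)`
  have hmem : ∀ p : I × I, pushHomotopy A ε z (p.1 : ℝ) (γ p.2) ∈ univ \ F := fun p =>
    ⟨mem_univ _, pushHomotopy_notMem hsep hz hF hzF huniq (hγF p.2) p.1.2.1 p.1.2.2⟩
  have hcont : Continuous fun p : I × I => pushHomotopy A ε z (p.1 : ℝ) (γ p.2) := by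
    have h := continuousOn_pushHomotopy (A := A) (ε := ε) (z := z)
    refine h.comp_continuous ((continuous_subtype_val.comp continuous_fst).prodMk
      (continuous_subtype_val.comp (γ.continuous.comp continuous_snd))) fun p => ?_
    exact fun a ha => hγz p.2 a ha
  let Fsq : C(I × I, ↥(univ \ F)) := ⟨fun p => ⟨_, hmem p⟩, hcont.subtype_mk _⟩
  have hx0 : ∀ s : I, pushHomotopy A ε z (s : ℝ) (x : ℂ) = x := fun s =>
    pushHomotopy_of_forall_notMem hz (fun a ha h => not_lt.2 (hx a ha) (mem_ball.1 h)) _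
  -- the pushed loop
  let γ' : Path x x :=
    { toFun := fun θ => Fsq (1, θ)
      continuous_toFun := Fsq.continuous.comp (by fun_prop)
      source' := Subtype.ext (by simpa [Fsq] using hx0 1)
      target' := Subtype.ext (by simpa [Fsq] using hx0 1) }
  refine ⟨γ', mk_eq_mk_of_square Fsq γ γ' (fun θ => Subtype.ext ?_) (fun θ => rfl)
    (fun s => Subtype.ext ?_) (fun s => Subtype.ext ?_), fun t a ha => ?_⟩
  · change pushHomotopy A ε z 0 (γ θ) = γ θ
    simp [pushHomotopy]
  · change pushHomotopy A ε z s (γ 0) = x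
    rw [γ.source]; exact hx0 s
  · change pushHomotopy A ε z s (γ 1) = x
    rw [γ.target]; exact hx0 s
  · change ε ≤ dist (pushHomotopy A ε z ((1 : I) : ℝ) (γ t)) a
    rw [Set.Icc.coe_one]
    exact le_dist_pushHomotopy_one hsep hz hzF (hγF t) ha

end Theorem



end OffDiscs

end Literature.AlgebraicTopology.FundamentalGroup

end
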